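import Literature.Geometry.Lorentzian.KerrSchild
import Mathlib.Analysis.Calculus.Deriv.MeanValue
import HarnessLib

/-!
# `CaptureSufficesTame` (stmt-FinalStateConjecture-17270), line `only-the-third-law-is-generic`, brick F1
# `stub_noC0_flatBasics`, helper: the causal cone of `η` on `E4` and the cone mean value theorem

Flat causal toolkit (namespace `NoC0Flat`) for the bricks `stub_noC0_flatBasics` / `stub_noC0_flatGenerators` of
skeleton v5 of the line. Conventions of the skeleton: `E4 = EuclideanSpace ℝ (Fin 4)`, index `0` is time,
`η = Minkowski.bilin`; a FLAT CAUSAL PATH inside `U ⊆ E4` on `[a, b]` is `γ : ℝ → E4` with `γ t ∈ U` and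
`γ' t = v` (`HasDerivAt`, two-sided, at every `t ∈ [a, b]`) future causal: `η(v, v) ≤ 0`, `v⁰ > 0`. Contents:

* cone algebra: reverse Cauchy–Schwarz for future causal vectors, the future causal cone is a convex cone, the
  null-ray identity `η(s d − δ ∂₀, s d − δ ∂₀) = 2 s δ d⁰ − δ²`;
* cone topology: the future timecone `{η(w, w) < 0, w⁰ > 0}` is open (with an `ε`-margin form);
* calculus of paths `ℝ → E4`: chords of a path with future timelike derivative are future timelike near the base
  point; two paths with the same value and derivative at a junction glue to a path differentiable there;
  concatenation of flat causal paths; the velocity of the parabolic arc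
  `t ↦ X + ((t−c)/T)² (Y − X) + ((t−c) − (t−c)²/T) v` used for `C¹` corner rounding;
* the CONE MEAN VALUE THEOREM (registered as `stub_noC0_flatConeMVT`): along a flat causal path the chord
  `γ b − γ a` is future causal and the time coordinate strictly increases (scalar monotonicity of `t ↦ η(n, γ t)` for
  every future causal `n`, and one explicit future null `n` to conclude).

References: B. O'Neill, *Semi-Riemannian geometry*, Academic Press 1983, Ch. 5, Lemmas 5.26–5.29 and pp. 146–147,
Ch. 10, Prop. 10.46; S. W. Hawking, G. F. R. Ellis, *The large scale structure of space-time*, CUP 1973, §5.1.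
-/

-- the doubled `FinalStateConjecture.FinalStateConjecture` path component trips dupNamespace (as in the skeleton)
set_option linter.dupNamespace false

noncomputable section

open scoped Topology
open Set Filter

namespace Summit.FinalStateConjecture.FinalStateConjecture.Theorems.PhaseMixingCaptureCaptureSufficesTame

open Literature.Geometry.Lorentzian

namespace NoC0Flat

/-! ## Cone algebra -/

/-- For a causal vector `v` (`η(v, v) ≤ 0`) the spatial square is at most the time square:
`∑ᵢ (vⁱ)² ≤ (v⁰)²` (O'Neill 1983, Ch. 5, p. 146). [cite: ONeill1983, Ch. 5, p. 146] -/
theorem spatial_sq_le_of_causal {v : E4} (hv : Minkowski.bilin v v ≤ 0) :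
    ∑ i : Fin 3, v i.succ * v i.succ ≤ v 0 * v 0 := by
  rw [Minkowski.bilin_apply] at hv
  linarith

/-- **Reverse Cauchy–Schwarz inequality** for the closed future causal cone of `ℝ⁴₁`: if `u`, `z` are causal with
nonnegative time components then `η(u, z) ≤ 0` (O'Neill 1983, Ch. 5, Lemma 5.29 and p. 146). [cite: ONeill1983, Ch. 5, Lemma 5.29] -/
theorem bilin_le_zero_of_causal {u z : E4} (hu : Minkowski.bilin u u ≤ 0) (hu0 : 0 ≤ u 0)
    (hz : Minkowski.bilin z z ≤ 0) (hz0 : 0 ≤ z 0) : Minkowski.bilin u z ≤ 0 := by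
  have hsu := spatial_sq_le_of_causal hu
  have hsz := spatial_sq_le_of_causal hz
  rw [Minkowski.bilin_apply]
  have hcs := Finset.sum_mul_sq_le_sq_mul_sq Finset.univ (fun i : Fin 3 ↦ u i.succ) (fun i ↦ z i.succ)
  simp only [pow_two] at hcs
  have hA : 0 ≤ ∑ i : Fin 3, u i.succ * u i.succ := Finset.sum_nonneg fun i _ ↦ mul_self_nonneg _
  have hB : 0 ≤ ∑ i : Fin 3, z i.succ * z i.succ := Finset.sum_nonneg fun i _ ↦ mul_self_nonneg _
  have h1 : (∑ i : Fin 3, u i.succ * z i.succ) * (∑ i : Fin 3, u i.succ * z i.succ) ≤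
      (u 0 * z 0) * (u 0 * z 0) := by
    calc (∑ i : Fin 3, u i.succ * z i.succ) * (∑ i : Fin 3, u i.succ * z i.succ)
        ≤ (∑ i : Fin 3, u i.succ * u i.succ) * ∑ i : Fin 3, z i.succ * z i.succ := hcs
      _ ≤ (u 0 * u 0) * (z 0 * z 0) := mul_le_mul hsu hsz hB (hA.trans hsu)
      _ = (u 0 * z 0) * (u 0 * z 0) := by ring
  have h2 : ∑ i : Fin 3, u i.succ * z i.succ ≤ u 0 * z 0 := by
    have h0 : 0 ≤ u 0 * z 0 := mul_nonneg hu0 hz0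
    nlinarith [h1, h0]
  linarith

/-- The closed future causal cone is closed under addition: `η(u + z, u + z) ≤ 0` for future causal `u`, `z`
(O'Neill 1983, Ch. 5, Lemma 5.29 / p. 146). [cite: ONeill1983, Ch. 5, p. 146] -/
theorem bilin_add_self_le_zero_of_causal {u z : E4} (hu : Minkowski.bilin u u ≤ 0) (hu0 : 0 ≤ u 0)
    (hz : Minkowski.bilin z z ≤ 0) (hz0 : 0 ≤ z 0) : Minkowski.bilin (u + z) (u + z) ≤ 0 := by
  have huz := bilin_le_zero_of_causal hu hu0 hz hz0
  have hzu : Minkowski.bilin z u ≤ 0 := by rw [Minkowski.bilin_symm]; exact huz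
  simp only [map_add, add_apply]
  linarith

/-- Homogeneity of the quadratic form: `η(c u, c u) = c² η(u, u)` (O'Neill 1983, Ch. 5, p. 146). [cite: ONeill1983, Ch. 5, p. 146] -/
theorem bilin_smul_self (c : ℝ) (u : E4) :
    Minkowski.bilin (c • u) (c • u) = c ^ 2 * Minkowski.bilin u u := by
  simp only [map_smul, smul_apply, smul_eq_mul]
  ring

/-- A nonnegative combination `α u + β z` (`α, β ≥ 0`, `α + β > 0`) of future causal vectors with positive time
components is future causal with positive time component: the future causal cone is a convex cone
(O'Neill 1983, Ch. 5, Lemma 5.29 / p. 146). [cite: ONeill1983, Ch. 5, p. 146] -/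
theorem causal_combo {u z : E4} (hu : Minkowski.bilin u u ≤ 0) (hu0 : 0 < u 0)
    (hz : Minkowski.bilin z z ≤ 0) (hz0 : 0 < z 0) {α β : ℝ} (hα : 0 ≤ α) (hβ : 0 ≤ β) (hαβ : 0 < α + β) :
    Minkowski.bilin (α • u + β • z) (α • u + β • z) ≤ 0 ∧ 0 < (α • u + β • z) 0 := by
  refine ⟨bilin_add_self_le_zero_of_causal ?_ ?_ ?_ ?_, ?_⟩
  · rw [bilin_smul_self]; exact mul_nonpos_of_nonneg_of_nonpos (sq_nonneg _) hu
  · simp only [PiLp.smul_apply, smul_eq_mul]; exact mul_nonneg hα hu0.le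
  · rw [bilin_smul_self]; exact mul_nonpos_of_nonneg_of_nonpos (sq_nonneg _) hz
  · simp only [PiLp.smul_apply, smul_eq_mul]; exact mul_nonneg hβ hz0.le
  · simp only [PiLp.add_apply, PiLp.smul_apply, smul_eq_mul]
    rcases hα.eq_or_lt with rfl | hα'
    · have hβ' : 0 < β := by simpa using hαβ
      nlinarith [mul_pos hβ' hz0]
    · nlinarith [mul_pos hα' hu0, mul_nonneg hβ hz0.le]

/-- Positive multiples of future timelike vectors are future timelike (O'Neill 1983, Ch. 5, p. 146: the timecone is
a cone). [cite: ONeill1983, Ch. 5, p. 146] -/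
theorem timelike_smul {w : E4} (hw : Minkowski.bilin w w < 0) (hw0 : 0 < w 0) {c : ℝ} (hc : 0 < c) :
    Minkowski.bilin (c • w) (c • w) < 0 ∧ 0 < (c • w) 0 := by
  refine ⟨?_, ?_⟩
  · rw [bilin_smul_self]; exact mul_neg_of_pos_of_neg (by positivity) hw
  · simp only [PiLp.smul_apply, smul_eq_mul]; exact mul_pos hc hw0

/-- The null-ray identity behind the achronality of null lines: for a null vector `d` (`η(d, d) = 0`),
`η(s d − δ ∂₀, s d − δ ∂₀) = 2 s δ d⁰ − δ²` and `(s d − δ ∂₀)⁰ = s d⁰ − δ`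
(O'Neill 1983, Ch. 5, p. 147; Ch. 14, Lemma 14.3). [cite: ONeill1983, Ch. 14, Lemma 14.3] -/
theorem bilin_ray_sub_basisVector {d : E4} (hd : Minkowski.bilin d d = 0) (s δ : ℝ) :
    Minkowski.bilin (s • d - δ • E4.basisVector 0) (s • d - δ • E4.basisVector 0) = 2 * s * δ * d 0 - δ ^ 2 ∧
      (s • d - δ • E4.basisVector 0) 0 = s * d 0 - δ := by
  rw [Minkowski.bilin_apply] at hd
  refine ⟨?_, by simp⟩
  rw [Minkowski.bilin_apply]
  simp [Fin.sum_univ_three, Fin.succ_ne_zero] at hd ⊢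
  linear_combination (s ^ 2) * hd

/-! ## Cone topology -/

/-- The quadratic form `w ↦ η(w, w)` is continuous on `E4` (O'Neill 1983, Ch. 5, p. 146). [cite: ONeill1983, Ch. 5, p. 146] -/
theorem continuous_bilin_self : Continuous fun w : E4 ↦ Minkowski.bilin w w := by
  have : (fun w : E4 ↦ Minkowski.bilin w w) =
      fun w : E4 ↦ -(w 0 * w 0) + ∑ i : Fin 3, w i.succ * w i.succ := by
    funext w; exact Minkowski.bilin_apply w w
  rw [this]
  fun_prop

/-- The time coordinate `w ↦ w⁰` is continuous on `E4` (coordinate projection). [folklore] -/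
theorem continuous_apply_zero : Continuous fun w : E4 ↦ w 0 := by
  fun_prop

/-- The future timecone `{w | η(w, w) < 0, w⁰ > 0}` of `ℝ⁴₁` is open (O'Neill 1983, Ch. 5, Lemma 5.26 ff.,
p. 146). [cite: ONeill1983, Ch. 5, p. 146] -/
theorem isOpen_timecone : IsOpen {w : E4 | Minkowski.bilin w w < 0 ∧ 0 < w 0} :=
  (isOpen_lt continuous_bilin_self continuous_const).inter (isOpen_lt continuous_const continuous_apply_zero)

/-- Margin form of the openness of the future timecone: a future timelike `w` stays future timelike under
perturbations of norm `< ε` (O'Neill 1983, Ch. 5, p. 146). [cite: ONeill1983, Ch. 5, p. 146] -/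
theorem exists_timecone_margin {w : E4} (hw : Minkowski.bilin w w < 0) (hw0 : 0 < w 0) :
    ∃ ε > 0, ∀ z : E4, dist z w < ε → Minkowski.bilin z z < 0 ∧ 0 < z 0 := by
  obtain ⟨ε, hε, hball⟩ := Metric.isOpen_iff.1 isOpen_timecone w ⟨hw, hw0⟩
  exact ⟨ε, hε, fun z hz ↦ hball hz⟩

/-! ## Two calculus facts for paths `ℝ → E4` -/

/-- **Chords of a path with a future timelike derivative are future timelike near the base point**: if
`σ' (t) = v` with `η(v, v) < 0`, `v⁰ > 0`, then for `t'` near `t`, `σ t' − σ t` is future timelike when `t' > t`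
and `σ t − σ t'` is future timelike when `t' < t` (the difference quotient tends to `v` and the timecone is an open
cone; O'Neill 1983, Ch. 5, p. 146). [cite: ONeill1983, Ch. 5, p. 146] -/
theorem eventually_chord_timelike {σ : ℝ → E4} {t : ℝ} {v : E4} (hσ : HasDerivAt σ v t)
    (hv : Minkowski.bilin v v < 0) (hv0 : 0 < v 0) :
    ∀ᶠ t' in 𝓝 t,
      (t < t' → Minkowski.bilin (σ t' - σ t) (σ t' - σ t) < 0 ∧ 0 < (σ t' - σ t) 0) ∧
      (t' < t → Minkowski.bilin (σ t - σ t') (σ t - σ t') < 0 ∧ 0 < (σ t - σ t') 0) := by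
  have hslope := hasDerivAt_iff_tendsto_slope.1 hσ
  have hmem : {w : E4 | Minkowski.bilin w w < 0 ∧ 0 < w 0} ∈ 𝓝 v := isOpen_timecone.mem_nhds ⟨hv, hv0⟩
  have hev : ∀ᶠ t' in 𝓝[≠] t, slope σ t t' ∈ {w : E4 | Minkowski.bilin w w < 0 ∧ 0 < w 0} := hslope hmem
  rw [eventually_nhdsWithin_iff] at hev
  filter_upwards [hev] with t' ht'
  refine ⟨fun hlt ↦ ?_, fun hlt ↦ ?_⟩
  · have h := ht' (by simpa using hlt.ne')
    rw [slope_def_module] at h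
    have hsc := timelike_smul h.1 h.2 (sub_pos.2 hlt)
    rwa [smul_smul, mul_inv_cancel₀ (sub_ne_zero.2 hlt.ne'), one_smul] at hsc
  · have h := ht' (by simpa using hlt.ne)
    rw [slope_def_module] at h
    have hsc := timelike_smul h.1 h.2 (sub_pos.2 hlt)
    have hts : (t - t') * (t' - t)⁻¹ = -1 := by
      rw [← neg_sub t' t, neg_mul, mul_inv_cancel₀ (sub_ne_zero.2 hlt.ne)]
    rwa [smul_smul, hts, neg_one_smul, neg_sub] at hsc

section Glue

variable {F : Type*}

/-- **Gluing two paths at a junction.** If `γ₁` and `γ₂` agree at `c` and both have derivative `v` at `c`, the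
concatenation `t ↦ if t ≤ c then γ₁ t else γ₂ t` has derivative `v` at `c` (one-sided derivatives on `(-∞, c]` and
`[c, ∞)` combine). [folklore] -/
theorem hasDerivAt_glue [NormedAddCommGroup F] [NormedSpace ℝ F] {γ₁ γ₂ : ℝ → F} {c : ℝ} {v : F}
    (h₁ : HasDerivAt γ₁ v c) (h₂ : HasDerivAt γ₂ v c) (hc : γ₁ c = γ₂ c) : HasDerivAt (fun t ↦ if t ≤ c then γ₁ t else γ₂ t) v c := by
  have H1 : HasDerivWithinAt (fun t ↦ if t ≤ c then γ₁ t else γ₂ t) v (Iic c) c :=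
    h₁.hasDerivWithinAt.congr (fun y hy ↦ by simp [mem_Iic.1 hy]) (by simp)
  have H2 : HasDerivWithinAt (fun t ↦ if t ≤ c then γ₁ t else γ₂ t) v (Ici c) c := by
    refine h₂.hasDerivWithinAt.congr (fun y hy ↦ ?_) (by simp [hc])
    rcases (mem_Ici.1 hy).eq_or_lt with rfl | hlt
    · simp [hc]
    · simp [not_le.2 hlt]
  have H := H1.union H2
  rw [Iic_union_Ici] at H
  exact H.hasDerivAt univ_mem

/-- Left of the junction the glued path is the first path (eventual equality in `𝓝 t` for `t < c`). [folklore] -/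
theorem glue_eventuallyEq_left {γ₁ γ₂ : ℝ → F} {c t : ℝ} (ht : t < c) :
    (fun t ↦ if t ≤ c then γ₁ t else γ₂ t) =ᶠ[𝓝 t] γ₁ := by
  filter_upwards [Iio_mem_nhds ht] with y hy
  simp [(mem_Iio.1 hy).le]

/-- Right of the junction the glued path is the second path (eventual equality in `𝓝 t` for `c < t`). [folklore] -/
theorem glue_eventuallyEq_right {γ₁ γ₂ : ℝ → F} {c t : ℝ} (ht : c < t) :
    (fun t ↦ if t ≤ c then γ₁ t else γ₂ t) =ᶠ[𝓝 t] γ₂ := by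
  filter_upwards [Ioi_mem_nhds ht] with y hy
  simp [not_le.2 (mem_Ioi.1 hy)]

end Glue

/-- The time component along a path: `HasDerivAt γ v t` gives `HasDerivAt (γ · ⁰) v⁰ t` (coordinate projection
is a continuous linear map). [folklore] -/
theorem hasDerivAt_apply_zero {γ : ℝ → E4} {v : E4} {t : ℝ} (h : HasDerivAt γ v t) :
    HasDerivAt (fun s ↦ γ s 0) (v 0) t := by
  have h' := ((EuclideanSpace.proj (0 : Fin 4) : StrongDual ℝ E4).hasFDerivAt).comp_hasDerivAt t h
  simpa [Function.comp_def] using h'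

/-- `η(n, ·)` along a path: `HasDerivAt γ v t` gives `HasDerivAt (η(n, γ ·)) (η(n, v)) t`. [folklore] -/
theorem hasDerivAt_bilin_left (n : E4) {γ : ℝ → E4} {v : E4} {t : ℝ} (h : HasDerivAt γ v t) :
    HasDerivAt (fun s ↦ Minkowski.bilin n (γ s)) (Minkowski.bilin n v) t :=
  (Minkowski.bilin n).hasFDerivAt.comp_hasDerivAt t h

/-! ## The cone mean value theorem -/

/-- **Linear functionals `η(n, ·)` with `n` future causal are non-increasing along flat causal paths**: if
`γ' = v` future causal on `[a, b]` and `η(n, n) ≤ 0`, `n⁰ ≥ 0`, then `η(n, γ b − γ a) ≤ 0` (scalar monotonicity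
theorem applied to `t ↦ η(n, γ t)`, whose derivative `η(n, v) ≤ 0` by reverse Cauchy–Schwarz; O'Neill 1983, Ch. 5,
p. 146). [cite: ONeill1983, Ch. 5, p. 146] -/
theorem bilin_chord_le_zero_of_causal {γ : ℝ → E4} {a b : ℝ} (hab : a ≤ b)
    (h : ∀ t ∈ Icc a b, ∃ v : E4, HasDerivAt γ v t ∧ Minkowski.bilin v v ≤ 0 ∧ 0 < v 0)
    {n : E4} (hn : Minkowski.bilin n n ≤ 0) (hn0 : 0 ≤ n 0) :
    Minkowski.bilin n (γ b - γ a) ≤ 0 := by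
  have hcont : ContinuousOn (fun s ↦ Minkowski.bilin n (γ s)) (Icc a b) := by
    intro t ht
    obtain ⟨v, hv, -⟩ := h t ht
    exact (hasDerivAt_bilin_left n hv).continuousAt.continuousWithinAt
  have hdiff : DifferentiableOn ℝ (fun s ↦ Minkowski.bilin n (γ s)) (interior (Icc a b)) := by
    intro t ht
    rw [interior_Icc] at ht
    obtain ⟨v, hv, -⟩ := h t (Ioo_subset_Icc_self ht)
    exact (hasDerivAt_bilin_left n hv).differentiableAt.differentiableWithinAt
  have hderiv : ∀ t ∈ interior (Icc a b), deriv (fun s ↦ Minkowski.bilin n (γ s)) t ≤ 0 := by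
    intro t ht
    rw [interior_Icc] at ht
    obtain ⟨v, hv, hvc, hv0⟩ := h t (Ioo_subset_Icc_self ht)
    rw [(hasDerivAt_bilin_left n hv).deriv]
    exact bilin_le_zero_of_causal hn hn0 hvc hv0.le
  have hanti := antitoneOn_of_deriv_nonpos (convex_Icc a b) hcont hdiff hderiv
  have hle := hanti (left_mem_Icc.2 hab) (right_mem_Icc.2 hab) hab
  simp only at hle
  rw [map_sub]
  linarith

/-- **The time coordinate is strictly increasing along a flat causal path** (`(γ ·)⁰` has positive derivative;
O'Neill 1983, Ch. 5, p. 147). [cite: ONeill1983, Ch. 5, p. 147] -/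
theorem strictMonoOn_time_of_causal {γ : ℝ → E4} {a b : ℝ}
    (h : ∀ t ∈ Icc a b, ∃ v : E4, HasDerivAt γ v t ∧ Minkowski.bilin v v ≤ 0 ∧ 0 < v 0) :
    StrictMonoOn (fun s ↦ γ s 0) (Icc a b) := by
  refine strictMonoOn_of_deriv_pos (convex_Icc a b) ?_ ?_
  · intro t ht
    obtain ⟨v, hv, -⟩ := h t ht
    exact (hasDerivAt_apply_zero hv).continuousAt.continuousWithinAt
  · intro t ht
    rw [interior_Icc] at ht
    obtain ⟨v, hv, -, hv0⟩ := h t (Ioo_subset_Icc_self ht)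
    rwa [(hasDerivAt_apply_zero hv).deriv]

/-- **Cone mean value theorem** for `ℝ⁴₁`: along a flat causal path on `[a, b]`, `a < b`, the chord `γ b − γ a`
is future causal with positive time component, `η(γ b − γ a, γ b − γ a) ≤ 0` and `(γ a)⁰ < (γ b)⁰` (if the chord
`w` were spacelike, the future null vector `n = w + (‖w⃗‖ − w⁰) ∂₀` would have `η(n, w) = ‖w⃗‖ (‖w⃗‖ − w⁰) > 0`,
contradicting the monotonicity of `η(n, γ ·)`; O'Neill 1983, Ch. 5, pp. 146–147, Ch. 10, Prop. 10.46 flat case).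
[cite: ONeill1983, Ch. 5, pp. 146–147] -/
theorem causal_chord_of_causalPath {γ : ℝ → E4} {a b : ℝ} (hab : a < b)
    (h : ∀ t ∈ Icc a b, ∃ v : E4, HasDerivAt γ v t ∧ Minkowski.bilin v v ≤ 0 ∧ 0 < v 0) :
    Minkowski.bilin (γ b - γ a) (γ b - γ a) ≤ 0 ∧ γ a 0 < γ b 0 := by
  have htime : γ a 0 < γ b 0 :=
    strictMonoOn_time_of_causal h (left_mem_Icc.2 hab.le) (right_mem_Icc.2 hab.le) hab
  refine ⟨?_, htime⟩
  set w : E4 := γ b - γ a with hw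
  have hw0 : 0 < w 0 := by simp only [hw, PiLp.sub_apply]; linarith
  by_contra hsp'
  have hsp : 0 < Minkowski.bilin w w := not_le.1 hsp'
  -- the spatial square `S` of `w` exceeds `(w⁰)²`
  set S : ℝ := ∑ i : Fin 3, w i.succ * w i.succ with hS
  have hS0 : 0 ≤ S := Finset.sum_nonneg fun i _ ↦ mul_self_nonneg _
  have hSw : w 0 * w 0 < S := by
    have := Minkowski.bilin_apply w w
    linarith
  set ρ : ℝ := Real.sqrt S with hρ
  have hρS : ρ * ρ = S := Real.mul_self_sqrt hS0
  have hρw : w 0 < ρ := by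
    rw [hρ, Real.lt_sqrt hw0.le, pow_two]
    exact hSw
  -- the future null vector `n = w + (ρ − w⁰) ∂₀`
  set n : E4 := w + (ρ - w 0) • E4.basisVector 0 with hn
  have hn0 : n 0 = ρ := by simp [hn]
  have hnsucc : ∀ i : Fin 3, n i.succ = w i.succ := fun i ↦ by simp [hn, Fin.succ_ne_zero]
  have hnn : Minkowski.bilin n n ≤ 0 := by
    rw [Minkowski.bilin_apply, hn0]
    simp only [hnsucc]
    linarith
  have hnw : Minkowski.bilin n w = ρ * (ρ - w 0) := by
    rw [Minkowski.bilin_apply, hn0]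
    simp only [hnsucc]
    rw [← hS]
    nlinarith [hρS]
  have hle := bilin_chord_le_zero_of_causal hab.le h hnn (by rw [hn0]; exact Real.sqrt_nonneg S)
  rw [← hw, hnw] at hle
  have : 0 < ρ * (ρ - w 0) := mul_pos (hw0.trans hρw) (sub_pos.2 hρw)
  linarith

/-! ## Concatenation and parabolic arcs -/

/-- **Concatenation of flat causal paths.** A flat causal path on `[a, c]` and one on `[c, b]` inside `U`, with the
same value and the same derivative at the junction `c`, glue to a flat causal path on `[a, b]` inside `U`
(`t ↦ if t ≤ c then γ₁ t else γ₂ t`). [folklore] -/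
theorem causalPath_append {U : Set E4} {γ₁ γ₂ : ℝ → E4} {a c b : ℝ} {v : E4}
    (h₁ : ∀ t ∈ Set.Icc a c, γ₁ t ∈ U ∧ ∃ w : E4, HasDerivAt γ₁ w t ∧ Minkowski.bilin w w ≤ 0 ∧ 0 < w 0)
    (h₂ : ∀ t ∈ Set.Icc c b, γ₂ t ∈ U ∧ ∃ w : E4, HasDerivAt γ₂ w t ∧ Minkowski.bilin w w ≤ 0 ∧ 0 < w 0)
    (hv₁ : HasDerivAt γ₁ v c) (hv₂ : HasDerivAt γ₂ v c) (heq : γ₁ c = γ₂ c) :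
    ∀ t ∈ Set.Icc a b, (fun t ↦ if t ≤ c then γ₁ t else γ₂ t) t ∈ U ∧
      ∃ w : E4, HasDerivAt (fun t ↦ if t ≤ c then γ₁ t else γ₂ t) w t ∧ Minkowski.bilin w w ≤ 0 ∧ 0 < w 0 := by
  intro t ht
  rcases lt_trichotomy t c with hlt | rfl | hgt
  · obtain ⟨hU, w, hw, hwc, hw0⟩ := h₁ t ⟨ht.1, hlt.le⟩
    refine ⟨by simpa [hlt.le] using hU, w, ?_, hwc, hw0⟩
    exact hw.congr_of_eventuallyEq (glue_eventuallyEq_left hlt)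
  · obtain ⟨hU, w, -, hwc, hw0⟩ := h₁ t ⟨ht.1, le_rfl⟩
    obtain ⟨-, w₂, hw₂, hwc₂, hw0₂⟩ := h₂ t ⟨le_rfl, ht.2⟩
    refine ⟨by simpa using hU, v, hasDerivAt_glue hv₁ hv₂ heq, ?_, ?_⟩
    · rw [hv₂.unique hw₂]; exact hwc₂
    · rw [hv₂.unique hw₂]; exact hw0₂
  · obtain ⟨hU, w, hw, hwc, hw0⟩ := h₂ t ⟨hgt.le, ht.2⟩
    refine ⟨by simpa [not_le.2 hgt] using hU, w, ?_, hwc, hw0⟩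
    exact hw.congr_of_eventuallyEq (glue_eventuallyEq_right hgt)

/-- **Velocity of the parabolic arc.** The arc `t ↦ X + ((t−c)/T)² (Y − X) + ((t−c) − (t−c)²/T) v` has derivative
`(1 − s) v + s ((2/T)(Y − X) − v)` at `t`, where `s = (t − c)/T` (polynomial calculus). [folklore] -/
theorem hasDerivAt_arc (X Y v : E4) (c T t : ℝ) (hT : T ≠ 0) :
    HasDerivAt (fun t ↦ X + ((t - c) / T) ^ 2 • (Y - X) + ((t - c) - (t - c) ^ 2 / T) • v)
      ((1 - (t - c) / T) • v + ((t - c) / T) • ((2 / T) • (Y - X) - v)) t := by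
  have h0 : HasDerivAt (fun t : ℝ ↦ t - c) 1 t := (hasDerivAt_id' t).sub_const c
  have h1 : HasDerivAt (fun t ↦ (t - c) / T) (1 / T) t := h0.div_const T
  have h2 := h1.fun_pow 2
  have hsq := h0.fun_pow 2
  have h3 := h0.fun_sub (hsq.div_const T)
  have H := ((hasDerivAt_const t X).fun_add (h2.smul_const (Y - X))).fun_add (h3.smul_const v)
  refine H.congr_deriv ?_
  ext i
  simp only [PiLp.add_apply, PiLp.smul_apply, PiLp.sub_apply, PiLp.zero_apply, smul_eq_mul]
  norm_num
  field_simp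
  ring

end NoC0Flat

/-- **Cone mean value theorem for flat causal paths (registered helper stub `stub_noC0_flatConeMVT` of brick F1).**
Along a flat causal path on `[a, b]`, `a < b` (differentiable at every point, `η(γ', γ') ≤ 0`, `γ'⁰ > 0`), the
chord `γ b − γ a` is future causal, `η(γ b − γ a, γ b − γ a) ≤ 0`, and the time coordinate strictly increases,
`(γ a)⁰ < (γ b)⁰` (O'Neill 1983, Ch. 5, pp. 146–147; Ch. 10, Prop. 10.46, flat case). [cite: ONeill1983, Ch. 5, pp. 146–147] -/
theorem stub_noC0_flatConeMVT :
    ∀ (γ : ℝ → E4) (a b : ℝ), a < b →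
      (∀ t ∈ Set.Icc a b, ∃ v : E4, HasDerivAt γ v t ∧ Minkowski.bilin v v ≤ 0 ∧ 0 < v 0) →
      Minkowski.bilin (γ b - γ a) (γ b - γ a) ≤ 0 ∧ γ a 0 < γ b 0 :=
  fun _ _ _ hab h ↦ NoC0Flat.causal_chord_of_causalPath hab h

end Summit.FinalStateConjecture.FinalStateConjecture.Theorems.PhaseMixingCaptureCaptureSufficesTame

end
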